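import Summits.HodgeConjecture.CorCM.Geometry.Facts
import Summits.HodgeConjecture.CorCM.Model.Universe
import Summits.HodgeConjecture.CorCM.CycleClassFacts
import Summits.HodgeConjecture.CorCM.GysinSurface
import Summits.HodgeConjecture.CorCM.Model.DiagonalDegree
import Summits.HodgeConjecture.CorCM.Model.ConjIsogeny
import HarnessLib

/-!
# The COR-CM model layer, model-1's rows: `ModelAxioms` fields of the Picard–CM model universe

Cell `pub-hodgecm2` (COR-CM), seat `model-1`.  For `U₀ = Model.universeOf hHD hI hU h₃` (the model universe of
`CorCM/Model/Universe.lean`; the model of record `picardCMUniverse` is its specialisation), the following fields of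
`U₀.ModelAxioms` (`CorCM/Geometry/Facts.lean`) are discharged as one-line applications of tree theorems over
`PicardCM.Var` / `BettiUniverse`: M05 `pull_id`, M06 `cup_comm1`, M08 `pull_alg`, M09 `Lefschetz11`, M10 `lift`,
M11 `cup_interchange`, M12 `cmEnd` (`CorCM/CycleClassFacts`), M18 `gysin_surface` (`CorCM/GysinSurface`), M19 `deg_diag`
(`CorCM/Model/{TopDegreeDeterminant,DiagonalDegree}`), M21 `conjIsogeny` modulo the cited record
`Shimura1998_Thm2_Cor` (`CorCM/Model/ConjIsogeny`), and the asides `tr_degree`, `alg_le_hodge`, `cup_alg`.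
All named facts (`hHD`, `hI`, `hU`, `h₃`, `hcor`) are explicit binders of each theorem.
-/

noncomputable section

/-! ## The junction theorems `universeOf_<field> : (universeOf hHD hI hU h₃).Fact_<field>` -/

namespace Summit.HodgeConjecture.CorCM

namespace Model

open Literature.NumberTheory.Automorphic.PicardCM
open Literature.AlgebraicGeometry.HodgeTheory
open Literature.AlgebraicGeometry.ComplexMultiplication (Shimura1998_Thm2_Cor)
open Literature.NumberTheory.Automorphic (cmConjRingHom embedding_cmConjRingHom)


/-- M05 `Fact_pull_id` of the model (tree `var_pull_id`). -/
theorem universeOf_pull_id (hHD : exists_isReal_hodgeModel) (hI : hodgePQ_independent_of_hodgeModel)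
    (hU : BallQuotientUniformisedDatum) (h₃ : CMAbelianVarietyRealised) :
    (universeOf hHD hI hU h₃).Fact_pull_id :=
  fun X k ↦ var_pull_id hU h₃ X k

/-- M06 `Fact_cup_comm1` of the model (tree `var_cup_comm1`). -/
theorem universeOf_cup_comm1 (hHD : exists_isReal_hodgeModel) (hI : hodgePQ_independent_of_hodgeModel)
    (hU : BallQuotientUniformisedDatum) (h₃ : CMAbelianVarietyRealised) :
    (universeOf hHD hI hU h₃).Fact_cup_comm1 :=
  fun X a b ↦ var_cup_comm1 hU h₃ X a b

/-- aside `Fact_tr_degree` of the model (tree `var_tr_degree`). -/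
theorem universeOf_tr_degree (hHD : exists_isReal_hodgeModel) (hI : hodgePQ_independent_of_hodgeModel)
    (hU : BallQuotientUniformisedDatum) (h₃ : CMAbelianVarietyRealised) :
    (universeOf hHD hI hU h₃).Fact_tr_degree :=
  fun X k hk ↦ var_tr_degree hU h₃ X k hk

/-- aside `Fact_alg_le_hodge` of the model (tree `var_alg_le_hodgeClasses`). -/
theorem universeOf_alg_le_hodge (hHD : exists_isReal_hodgeModel) (hI : hodgePQ_independent_of_hodgeModel)
    (hU : BallQuotientUniformisedDatum) (h₃ : CMAbelianVarietyRealised) :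
    (universeOf hHD hI hU h₃).Fact_alg_le_hodge :=
  fun X p ↦ var_alg_le_hodgeClasses hHD hI hU h₃ X p

/-- M08 `Fact_pull_alg` of the model (tree `var_pull_alg`). -/
theorem universeOf_pull_alg (hHD : exists_isReal_hodgeModel) (hI : hodgePQ_independent_of_hodgeModel)
    (hU : BallQuotientUniformisedDatum) (h₃ : CMAbelianVarietyRealised) :
    (universeOf hHD hI hU h₃).Fact_pull_alg :=
  fun X Y f p ↦ var_pull_alg hU h₃ X Y f p

/-- aside `Fact_cup_alg` of the model (tree `var_cup_alg`). -/
theorem universeOf_cup_alg (hHD : exists_isReal_hodgeModel) (hI : hodgePQ_independent_of_hodgeModel)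
    (hU : BallQuotientUniformisedDatum) (h₃ : CMAbelianVarietyRealised) :
    (universeOf hHD hI hU h₃).Fact_cup_alg :=
  fun X x y hx hy ↦ var_cup_alg hU h₃ X x y hx hy

/-- M09 `Fact_Lefschetz11` of the model (tree `var_lefschetz11`). -/
theorem universeOf_lefschetz11 (hHD : exists_isReal_hodgeModel) (hI : hodgePQ_independent_of_hodgeModel)
    (hU : BallQuotientUniformisedDatum) (h₃ : CMAbelianVarietyRealised) :
    (universeOf hHD hI hU h₃).Fact_Lefschetz11 :=
  fun X ↦ var_lefschetz11 hHD hI hU h₃ X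

/-- M10 `Fact_lift` of the model (tree `var_lift`). -/
theorem universeOf_lift (hHD : exists_isReal_hodgeModel) (hI : hodgePQ_independent_of_hodgeModel)
    (hU : BallQuotientUniformisedDatum) (h₃ : CMAbelianVarietyRealised) :
    (universeOf hHD hI hU h₃).Fact_lift :=
  fun X Y Z f g ↦ var_lift hU h₃ X Y Z f g

/-- M11 `Fact_cup_interchange` of the model (tree `var_cup_interchange`). -/
theorem universeOf_cup_interchange (hHD : exists_isReal_hodgeModel) (hI : hodgePQ_independent_of_hodgeModel)
    (hU : BallQuotientUniformisedDatum) (h₃ : CMAbelianVarietyRealised) :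
    (universeOf hHD hI hU h₃).Fact_cup_interchange :=
  fun X a b c d ↦ var_cup_interchange hU h₃ X a b c d

/-- M12 `Fact_cmEnd` of the model (tree `var_cmEnd`). -/
theorem universeOf_cmEnd (hHD : exists_isReal_hodgeModel) (hI : hodgePQ_independent_of_hodgeModel)
    (hU : BallQuotientUniformisedDatum) (h₃ : CMAbelianVarietyRealised) :
    (universeOf hHD hI hU h₃).Fact_cmEnd :=
  fun K Φ a ↦ var_cmEnd hHD hI hU h₃ (cmCode K Φ) (cmCodeEquiv K Φ) a

/-- M18 `Fact_gysin_surface` of the model (tree `var_gysin_surface`). -/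
theorem universeOf_gysin_surface (hHD : exists_isReal_hodgeModel) (hI : hodgePQ_independent_of_hodgeModel)
    (hU : BallQuotientUniformisedDatum) (h₃ : CMAbelianVarietyRealised) :
    (universeOf hHD hI hU h₃).Fact_gysin_surface :=
  fun S X f hS ↦ var_gysin_surface hU h₃ S X f hS

/-- M19 `Fact_deg_diag` of the model (tree `var_deg_diag`; `IsDiagAct` destructured, its intertwinings at `k = 1`). -/
theorem universeOf_deg_diag (hHD : exists_isReal_hodgeModel) (hI : hodgePQ_independent_of_hodgeModel)
    (hU : BallQuotientUniformisedDatum) (h₃ : CMAbelianVarietyRealised) :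
    (universeOf hHD hI hU h₃).Fact_deg_diag := by
  rintro K Φ a M ⟨d, hd, hM⟩ k
  exact var_deg_diag hHD hI hU h₃ (fun i ↦ cmCode K (Φ i)) (fun i ↦ cmCodeEquiv K (Φ i)) a M d hd
    (hM 0 1) (hM 1 1) (hM 2 1) (hM 3 1) k

/-- M21 `Fact_conjIsogeny` of the model, under Shimura's Corollary (tree `var_conjIsogeny`). -/
theorem universeOf_conjIsogeny (hHD : exists_isReal_hodgeModel) (hI : hodgePQ_independent_of_hodgeModel)
    (hU : BallQuotientUniformisedDatum) (h₃ : CMAbelianVarietyRealised)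
    (hcor : Shimura1998_Thm2_Cor) : (universeOf hHD hI hU h₃).Fact_conjIsogeny := by
  intro K Φ Φ' hΦ
  have hΨ : ∀ σ : ((cmCode K Φ).E : Type) →+* ℂ,
      σ ∈ (cmCode K Φ').Φ.1 ↔ NumberField.ComplexEmbedding.conjugate σ ∈ (cmCode K Φ).Φ.1 :=
    fun σ ↦ hΦ (σ.comp (cmCodeEquiv K Φ).toRingHom)
  -- `var_conjIsogeny` applied to the components of the code `cmCode K Φ` (explicitly, so that the two codes
  -- `cmCode K Φ`, `cmCode K Φ'` — same field, same instances, different types — are seen by structure eta)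
  have h := @var_conjIsogeny hHD hI hU h₃ hcor (cmCode K Φ).E (cmCode K Φ).isNumberField
    (cmCode K Φ).isCMField (cmCode K Φ).Φ (cmCode K Φ').Φ K _ _
    (cmCodeEquiv K Φ) (NumberField.IsCMField.complexConj K).toRingEquiv
    (fun τ x ↦ embedding_cmConjRingHom K τ x) hΨ
  exact h

end Model

end Summit.HodgeConjecture.CorCM

end
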